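import Mathlib
import Literature.Analysis.FluidPDE.VectorCalculus
import Summits.NavierStokesRegularity.NavierStokesRegularity.Theorems.FilamentSkeletonRssSkeletonEquilibriumDihedralExclusion

/-!
# `SkeletonEquilibrium` (stmt-NavierStokesRegularity-15400): dihedral rigidity — a half-turn-symmetric relative equilibrium has ONE filament, through the centre

Negative-side structural helper for the (held) support item `FilamentSkeletonRss.SkeletonEquilibrium`
(`--supports stmt-NavierStokesRegularity-15400`): the GLOBAL form of the symmetry exclusions
`…HelixExclusion` (p830741), `…HalfTurnExclusion` (p830830), `…DihedralExclusion` (p830893, marked-point form).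

Setting (all hypotheses are clauses of the crux or coordinate identities; def-free). `N` differentiable proper
filaments `Ξ_k`, circulation ratios `γ_k`, the crux's regularised induction
`u(x) = Σ_k (Γγ_k/4π) ∫ ((‖x − Ξ_k σ‖² + 1)^{3/2})⁻¹ • Ξ_k′σ × (x − Ξ_k σ) dσ` with its integrability clause, and
the tangency clause `u(Ξ_k τ) + ½ Ξ_k τ − α e₃ × Ξ_k τ = w_k τ • Ξ_k′ τ` for ALL `(k, τ)`. DIHEDRAL SYMMETRY: for
the half-turn `ρ(x, y, z) = (x, −y, 2z₀ − z)` about the horizontal line `ℓ = {(s, 0, z₀)}` meeting the rotation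
axis at the centre `p = (0, 0, z₀)`, and an involutive relabelling `π` of `Fin N` with `γ ∘ π = γ`:
`Ξ_{πk}(−σ) = ρ(Ξ_k(σ))` (coordinates: `hsym`). No marked point and no fixed filament are assumed here.

* `integral_apply_partner` — transformation of the induction under the symmetry at an ARBITRARY field point:
  for `x′ = ρ x`, `(∫ G_{πk}(x′))₀ = −(∫ G_k(x))₀`, `(∫ G_{πk}(x′))₁ = (∫ G_k(x))₁`, `(∫ G_{πk}(x′))₂ = (∫ G_k(x))₂`
  (i.e. `u_{πk}(ρx) = −H u_k(x)`, `H = dρ = diag(1,−1,−1)`: `ρ` is a proper rotation, orientations are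
  reversed; change of variables `σ ↦ −σ`, integrability clause to pass to components).
* `induction_apply_partner` — summing with `γ_{πk} = γ_k` and reindexing by `π`: `u(ρx) = −H u(x)` (components).
* `radial_law_of_dihedral` — ★ tangency at `(k, τ)` and at `(πk, −τ)` combine (apply `H` to the first, add:
  the inductions cancel, `HJ = −JH` kills the rotation, `½(ρy + Hy) = H(y − p)`… ) to the RADIAL LAW
  `Ξ_k τ − p = (w_k τ − w_{πk}(−τ)) • Ξ_k′ τ`: every position vector from the centre is tangent.
* `exists_eq_centre_of_dihedral` — ★ hence EVERY filament passes through the centre `p`: `g = ‖Ξ_k − p‖²` is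
  proper and continuous, so it has a global minimum, where `g′ = 2⟪Ξ_k − p, Ξ_k′⟫ = 0`; with the radial law
  `⟪λΞ_k′, Ξ_k′⟫ = λ‖Ξ_k′‖² = 0` forces `Ξ_k − p = λ Ξ_k′ = 0` (no unit-speed clause needed).
* `subsingleton_of_dihedral` / `card_le_one_of_dihedral` — ★ with the separation clause
  (`0 < d ≤ ‖Ξ_k τ − Ξ_m σ‖` for `k ≠ m`) two filaments cannot share `p`: `N ≤ 1`. So a dihedrally symmetric
  witness of `SkeletonEquilibrium` does not exist for `N ≥ 2`, and for `N = 1` it passes through the axis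
  (where `…DihedralExclusion`/(c1) leave only the axis itself): EVERY GENUINE WITNESS IS HALF-TURN-CHIRAL —
  in particular no `C_N`-orbit of a half-turn-symmetric strand with equal circulations (the symmetric bending
  of the route's `C₃`/`C₄` straight inner data) is ever a witness. This makes the informal gloss of
  `…DihedralExclusion` («no dihedral configuration with N ≥ 2») a theorem for a single half-turn as well.
  (Mechanism: a horizontal half-turn conjugates the frame rotation `J ↦ −J`; with orientation reversal the
  Biot–Savart term and the rotation term are both equivariant but the Leray drift `½x` picks up the
  translation `z₀e₃`, leaving the rigid identity `y − p ∥ Ξ′`.)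

Mathlib + `Literature.Analysis.FluidPDE.VectorCalculus` (`cross`) + `…DihedralExclusion`
(`deriv_apply_neg_of_affine_relation`); no route file imported.
-/

-- `NavierStokesRegularity.NavierStokesRegularity` is the summit/problem path (D-0017), flagged by dupNamespace.
set_option linter.dupNamespace false

namespace Summit.NavierStokesRegularity.NavierStokesRegularity.Theorems.SkeletonEquilibrium.DihedralRigidity

open Literature.Analysis.FluidPDE MeasureTheory Filter
open scoped RealInnerProductSpace InnerProductSpace BigOperators Topology
open Summit.NavierStokesRegularity.NavierStokesRegularity.Theorems.SkeletonEquilibrium.DihedralExclusion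
  (deriv_apply_neg_of_affine_relation)

/-- Components of the cross product `v × w`. [folklore] -/
private theorem cross_apply_fin3 (v w : EuclideanSpace ℝ (Fin 3)) :
    cross v w 0 = v 1 * w 2 - v 2 * w 1 ∧ cross v w 1 = v 2 * w 0 - v 0 * w 2 ∧
      cross v w 2 = v 0 * w 1 - v 1 * w 0 := by
  refine ⟨?_, ?_, ?_⟩ <;> simp [cross, cross_apply]

/-- `⟪eᵢ, v⟫ = v i`. [folklore] -/
private theorem inner_single_left' (i : Fin 3) (v : EuclideanSpace ℝ (Fin 3)) :
    ⟪EuclideanSpace.single i (1 : ℝ), v⟫ = v i := by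
  rw [EuclideanSpace.inner_single_left]; simp

/-- Components of the frame rotation `e₃ × v = (−v₁, v₀, 0)`. [folklore] -/
private theorem cross_e3_apply (v : EuclideanSpace ℝ (Fin 3)) :
    cross (EuclideanSpace.single (2 : Fin 3) (1 : ℝ)) v 0 = -v 1 ∧
      cross (EuclideanSpace.single (2 : Fin 3) (1 : ℝ)) v 1 = v 0 ∧
      cross (EuclideanSpace.single (2 : Fin 3) (1 : ℝ)) v 2 = 0 := by
  obtain ⟨h0, h1, h2⟩ := cross_apply_fin3 (EuclideanSpace.single (2 : Fin 3) (1 : ℝ)) v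
  rw [h0, h1, h2]
  refine ⟨?_, ?_, ?_⟩ <;> simp

/-- A component of a Bochner integral of an integrable `ℝ³`-valued function is the integral of the
component. [folklore] -/
private theorem integral_apply_eq {F : ℝ → EuclideanSpace ℝ (Fin 3)} (hF : Integrable F) (i : Fin 3) :
    (∫ σ, F σ) i = ∫ σ, F σ i := by
  rw [← inner_single_left' i, ← integral_inner hF]
  exact integral_congr_ae (Eventually.of_forall fun σ => inner_single_left' i (F σ))

section Dihedral

variable {N : ℕ} {z₀ : ℝ} {Ξ : Fin N → ℝ → EuclideanSpace ℝ (Fin 3)} {π : Fin N → Fin N}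
  (hd : ∀ k, Differentiable ℝ (Ξ k))
  (hsym : ∀ k σ, Ξ (π k) (-σ) 0 = Ξ k σ 0 ∧ Ξ (π k) (-σ) 1 = -(Ξ k σ 1) ∧
    Ξ (π k) (-σ) 2 = 2 * z₀ - Ξ k σ 2)
include hd hsym

/-- Velocity symmetry of `ρ`-partners: `Ξ_{πk}′(−σ) = (−Ξ_k′σ₀, Ξ_k′σ₁, Ξ_k′σ₂) = −H Ξ_k′σ`. [folklore] -/
theorem deriv_apply_partner (k : Fin N) (σ : ℝ) :
    deriv (Ξ (π k)) (-σ) 0 = -(deriv (Ξ k) σ 0) ∧ deriv (Ξ (π k)) (-σ) 1 = deriv (Ξ k) σ 1 ∧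
      deriv (Ξ (π k)) (-σ) 2 = deriv (Ξ k) σ 2 := by
  refine ⟨?_, ?_, ?_⟩
  · have h := deriv_apply_neg_of_affine_relation (hd k) (hd (π k)) 0 1 0
      (fun σ' => by rw [(hsym k σ').1]; ring) σ
    linarith
  · have h := deriv_apply_neg_of_affine_relation (hd k) (hd (π k)) 1 (-1) 0
      (fun σ' => by rw [(hsym k σ').2.1]; ring) σ
    linarith
  · have h := deriv_apply_neg_of_affine_relation (hd k) (hd (π k)) 2 (-1) (2 * z₀)
      (fun σ' => by rw [(hsym k σ').2.2]; ring) σ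
    linarith

/-- The induction integrand at the image field point `x′ = ρx` and parameter `−σ` on the partner filament
`πk` is `−H` of the integrand at `x`, `σ` on filament `k` (components). [folklore] -/
theorem integrand_apply_partner (k : Fin N) (x x' : EuclideanSpace ℝ (Fin 3))
    (hx' : x' 0 = x 0 ∧ x' 1 = -(x 1) ∧ x' 2 = 2 * z₀ - x 2) (σ : ℝ) :
    (((‖x' - Ξ (π k) (-σ)‖ ^ 2 + 1) ^ (3 / 2 : ℝ))⁻¹ •
        cross (deriv (Ξ (π k)) (-σ)) (x' - Ξ (π k) (-σ))) 0 =
      -((((‖x - Ξ k σ‖ ^ 2 + 1) ^ (3 / 2 : ℝ))⁻¹ • cross (deriv (Ξ k) σ) (x - Ξ k σ)) 0) ∧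
    (((‖x' - Ξ (π k) (-σ)‖ ^ 2 + 1) ^ (3 / 2 : ℝ))⁻¹ •
        cross (deriv (Ξ (π k)) (-σ)) (x' - Ξ (π k) (-σ))) 1 =
      (((‖x - Ξ k σ‖ ^ 2 + 1) ^ (3 / 2 : ℝ))⁻¹ • cross (deriv (Ξ k) σ) (x - Ξ k σ)) 1 ∧
    (((‖x' - Ξ (π k) (-σ)‖ ^ 2 + 1) ^ (3 / 2 : ℝ))⁻¹ •
        cross (deriv (Ξ (π k)) (-σ)) (x' - Ξ (π k) (-σ))) 2 =
      (((‖x - Ξ k σ‖ ^ 2 + 1) ^ (3 / 2 : ℝ))⁻¹ • cross (deriv (Ξ k) σ) (x - Ξ k σ)) 2 := by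
  obtain ⟨hx0, hx1, hx2⟩ := hx'
  obtain ⟨hn0, hn1, hn2⟩ := hsym k σ
  obtain ⟨hd0, hd1, hd2⟩ := deriv_apply_partner hd hsym k σ
  have hnorm : ‖x' - Ξ (π k) (-σ)‖ = ‖x - Ξ k σ‖ := by
    rw [EuclideanSpace.norm_eq, EuclideanSpace.norm_eq]
    congr 1
    simp only [Fin.sum_univ_three, PiLp.sub_apply, hx0, hx1, hx2, hn0, hn1, hn2, Real.norm_eq_abs,
      sq_abs]
    ring
  obtain ⟨c0, c1, c2⟩ := cross_apply_fin3 (deriv (Ξ (π k)) (-σ)) (x' - Ξ (π k) (-σ))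
  obtain ⟨d0, d1, d2⟩ := cross_apply_fin3 (deriv (Ξ k) σ) (x - Ξ k σ)
  simp only [PiLp.smul_apply, smul_eq_mul, hnorm, c0, c1, c2, d0, d1, d2, PiLp.sub_apply, hx0, hx1, hx2,
    hn0, hn1, hn2, hd0, hd1, hd2]
  refine ⟨?_, ?_, ?_⟩ <;> ring

/-- **Transformation of one filament's induction under the symmetry**, at an arbitrary field point:
`u_{πk}(ρx) = −H u_k(x)` in components, given the integrability clause at `(k, x)` and `(πk, ρx)`.
[folklore] -/
theorem integral_apply_partner (k : Fin N) (x x' : EuclideanSpace ℝ (Fin 3))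
    (hx' : x' 0 = x 0 ∧ x' 1 = -(x 1) ∧ x' 2 = 2 * z₀ - x 2)
    (hI : Integrable (fun σ : ℝ => ((‖x - Ξ k σ‖ ^ 2 + 1) ^ (3 / 2 : ℝ))⁻¹ •
      cross (deriv (Ξ k) σ) (x - Ξ k σ)))
    (hI' : Integrable (fun σ : ℝ => ((‖x' - Ξ (π k) σ‖ ^ 2 + 1) ^ (3 / 2 : ℝ))⁻¹ •
      cross (deriv (Ξ (π k)) σ) (x' - Ξ (π k) σ))) :
    (∫ σ : ℝ, ((‖x' - Ξ (π k) σ‖ ^ 2 + 1) ^ (3 / 2 : ℝ))⁻¹ •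
        cross (deriv (Ξ (π k)) σ) (x' - Ξ (π k) σ)) 0 =
      -((∫ σ : ℝ, ((‖x - Ξ k σ‖ ^ 2 + 1) ^ (3 / 2 : ℝ))⁻¹ • cross (deriv (Ξ k) σ) (x - Ξ k σ)) 0) ∧
    (∫ σ : ℝ, ((‖x' - Ξ (π k) σ‖ ^ 2 + 1) ^ (3 / 2 : ℝ))⁻¹ •
        cross (deriv (Ξ (π k)) σ) (x' - Ξ (π k) σ)) 1 =
      (∫ σ : ℝ, ((‖x - Ξ k σ‖ ^ 2 + 1) ^ (3 / 2 : ℝ))⁻¹ • cross (deriv (Ξ k) σ) (x - Ξ k σ)) 1 ∧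
    (∫ σ : ℝ, ((‖x' - Ξ (π k) σ‖ ^ 2 + 1) ^ (3 / 2 : ℝ))⁻¹ •
        cross (deriv (Ξ (π k)) σ) (x' - Ξ (π k) σ)) 2 =
      (∫ σ : ℝ, ((‖x - Ξ k σ‖ ^ 2 + 1) ^ (3 / 2 : ℝ))⁻¹ • cross (deriv (Ξ k) σ) (x - Ξ k σ)) 2 := by
  rw [integral_apply_eq hI' 0, integral_apply_eq hI' 1, integral_apply_eq hI' 2, integral_apply_eq hI 0,
    integral_apply_eq hI 1, integral_apply_eq hI 2,
    ← integral_neg_eq_self (fun σ => (((‖x' - Ξ (π k) σ‖ ^ 2 + 1) ^ (3 / 2 : ℝ))⁻¹ •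
      cross (deriv (Ξ (π k)) σ) (x' - Ξ (π k) σ)) 0) volume,
    ← integral_neg_eq_self (fun σ => (((‖x' - Ξ (π k) σ‖ ^ 2 + 1) ^ (3 / 2 : ℝ))⁻¹ •
      cross (deriv (Ξ (π k)) σ) (x' - Ξ (π k) σ)) 1) volume,
    ← integral_neg_eq_self (fun σ => (((‖x' - Ξ (π k) σ‖ ^ 2 + 1) ^ (3 / 2 : ℝ))⁻¹ •
      cross (deriv (Ξ (π k)) σ) (x' - Ξ (π k) σ)) 2) volume,
    ← integral_neg]
  refine ⟨integral_congr_ae (Eventually.of_forall fun σ => ?_),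
    integral_congr_ae (Eventually.of_forall fun σ => ?_),
    integral_congr_ae (Eventually.of_forall fun σ => ?_)⟩
  · exact (integrand_apply_partner hd hsym k x x' hx' σ).1
  · exact (integrand_apply_partner hd hsym k x x' hx' σ).2.1
  · exact (integrand_apply_partner hd hsym k x x' hx' σ).2.2

/-- **Transformation of the total induction**: with `π` an involution and `γ_{πk} = γ_k`,
`u(ρx) = −H u(x)` (components), given the integrability clause of the crux at every `(k, x)`. [folklore] -/
theorem induction_apply_partner (hπ : ∀ k, π (π k) = k) (γ : Fin N → ℝ) (hγ : ∀ k, γ (π k) = γ k)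
    (Γ : ℝ)
    (hint : ∀ k (x : EuclideanSpace ℝ (Fin 3)), Integrable (fun σ : ℝ =>
      ((‖x - Ξ k σ‖ ^ 2 + 1) ^ (3 / 2 : ℝ))⁻¹ • cross (deriv (Ξ k) σ) (x - Ξ k σ)))
    (x x' : EuclideanSpace ℝ (Fin 3)) (hx' : x' 0 = x 0 ∧ x' 1 = -(x 1) ∧ x' 2 = 2 * z₀ - x 2) :
    (∑ k : Fin N, (Γ * γ k / (4 * Real.pi)) • ∫ σ : ℝ, ((‖x' - Ξ k σ‖ ^ 2 + 1) ^ (3 / 2 : ℝ))⁻¹ •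
        cross (deriv (Ξ k) σ) (x' - Ξ k σ)) 0 =
      -((∑ k : Fin N, (Γ * γ k / (4 * Real.pi)) • ∫ σ : ℝ, ((‖x - Ξ k σ‖ ^ 2 + 1) ^ (3 / 2 : ℝ))⁻¹ •
        cross (deriv (Ξ k) σ) (x - Ξ k σ)) 0) ∧
    (∑ k : Fin N, (Γ * γ k / (4 * Real.pi)) • ∫ σ : ℝ, ((‖x' - Ξ k σ‖ ^ 2 + 1) ^ (3 / 2 : ℝ))⁻¹ •
        cross (deriv (Ξ k) σ) (x' - Ξ k σ)) 1 =
      (∑ k : Fin N, (Γ * γ k / (4 * Real.pi)) • ∫ σ : ℝ, ((‖x - Ξ k σ‖ ^ 2 + 1) ^ (3 / 2 : ℝ))⁻¹ •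
        cross (deriv (Ξ k) σ) (x - Ξ k σ)) 1 ∧
    (∑ k : Fin N, (Γ * γ k / (4 * Real.pi)) • ∫ σ : ℝ, ((‖x' - Ξ k σ‖ ^ 2 + 1) ^ (3 / 2 : ℝ))⁻¹ •
        cross (deriv (Ξ k) σ) (x' - Ξ k σ)) 2 =
      (∑ k : Fin N, (Γ * γ k / (4 * Real.pi)) • ∫ σ : ℝ, ((‖x - Ξ k σ‖ ^ 2 + 1) ^ (3 / 2 : ℝ))⁻¹ •
        cross (deriv (Ξ k) σ) (x - Ξ k σ)) 2 := by
  -- abbreviate the per-filament integrals at x and x'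
  set I : Fin N → EuclideanSpace ℝ (Fin 3) := fun k => ∫ σ : ℝ, ((‖x - Ξ k σ‖ ^ 2 + 1) ^ (3 / 2 : ℝ))⁻¹ •
    cross (deriv (Ξ k) σ) (x - Ξ k σ) with hI
  set I' : Fin N → EuclideanSpace ℝ (Fin 3) := fun k => ∫ σ : ℝ, ((‖x' - Ξ k σ‖ ^ 2 + 1) ^ (3 / 2 : ℝ))⁻¹ •
    cross (deriv (Ξ k) σ) (x' - Ξ k σ) with hI'
  have hpart : ∀ k, I' (π k) 0 = -(I k 0) ∧ I' (π k) 1 = I k 1 ∧ I' (π k) 2 = I k 2 := fun k =>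
    integral_apply_partner hd hsym k x x' hx' (hint k x) (hint (π k) x')
  have hbij : Function.Bijective π := Function.Involutive.bijective hπ
  -- components of the sums
  have hcomp : ∀ (i : Fin 3) (J : Fin N → EuclideanSpace ℝ (Fin 3)),
      (∑ k : Fin N, (Γ * γ k / (4 * Real.pi)) • J k) i = ∑ k : Fin N, Γ * γ k / (4 * Real.pi) * J k i := by
    intro i J
    rw [← inner_single_left' i]
    simp_rw [inner_sum, real_inner_smul_right, inner_single_left']
  have hre : ∀ (i : Fin 3), ∑ k : Fin N, Γ * γ k / (4 * Real.pi) * I' k i =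
      ∑ k : Fin N, Γ * γ (π k) / (4 * Real.pi) * I' (π k) i := fun i =>
    (Fintype.sum_bijective π hbij (fun k => Γ * γ (π k) / (4 * Real.pi) * I' (π k) i)
      (fun k => Γ * γ k / (4 * Real.pi) * I' k i) (fun k => rfl)).symm
  change (∑ k : Fin N, (Γ * γ k / (4 * Real.pi)) • I' k) 0 = -((∑ k : Fin N, (Γ * γ k / (4 * Real.pi)) • I k) 0) ∧
    (∑ k : Fin N, (Γ * γ k / (4 * Real.pi)) • I' k) 1 = (∑ k : Fin N, (Γ * γ k / (4 * Real.pi)) • I k) 1 ∧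
    (∑ k : Fin N, (Γ * γ k / (4 * Real.pi)) • I' k) 2 = (∑ k : Fin N, (Γ * γ k / (4 * Real.pi)) • I k) 2
  rw [hcomp 0 I', hcomp 0 I, hcomp 1 I', hcomp 1 I, hcomp 2 I', hcomp 2 I, hre 0, hre 1, hre 2,
    ← Finset.sum_neg_distrib]
  refine ⟨Finset.sum_congr rfl fun k _ => ?_, Finset.sum_congr rfl fun k _ => ?_,
    Finset.sum_congr rfl fun k _ => ?_⟩
  · rw [hγ k, (hpart k).1]; ring
  · rw [hγ k, (hpart k).2.1]
  · rw [hγ k, (hpart k).2.2]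

/-- ★ **Radial law of a dihedral relative equilibrium.** If the tangency clause of `SkeletonEquilibrium` holds
at every `(k, τ)`, then for every filament `k` and parameter `τ`,
`Ξ_k τ − p = (w_k τ − w_{πk}(−τ)) • Ξ_k′ τ` with the centre `p = z₀ e₃`: every position vector from the
centre is tangent to the filament. [folklore] -/
theorem radial_law_of_dihedral (hπ : ∀ k, π (π k) = k) (γ : Fin N → ℝ) (hγ : ∀ k, γ (π k) = γ k)
    (Γ α : ℝ) (w : Fin N → ℝ → ℝ)
    (hint : ∀ k (x : EuclideanSpace ℝ (Fin 3)), Integrable (fun σ : ℝ =>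
      ((‖x - Ξ k σ‖ ^ 2 + 1) ^ (3 / 2 : ℝ))⁻¹ • cross (deriv (Ξ k) σ) (x - Ξ k σ)))
    (heq : ∀ k τ, (∑ m : Fin N, (Γ * γ m / (4 * Real.pi)) • ∫ σ : ℝ,
        ((‖Ξ k τ - Ξ m σ‖ ^ 2 + 1) ^ (3 / 2 : ℝ))⁻¹ • cross (deriv (Ξ m) σ) (Ξ k τ - Ξ m σ)) +
        (1 / 2 : ℝ) • Ξ k τ - α • cross (EuclideanSpace.single (2 : Fin 3) (1 : ℝ)) (Ξ k τ) =
        w k τ • deriv (Ξ k) τ)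
    (k : Fin N) (τ : ℝ) :
    Ξ k τ - z₀ • EuclideanSpace.single (2 : Fin 3) (1 : ℝ) =
      (w k τ - w (π k) (-τ)) • deriv (Ξ k) τ := by
  have hx' : Ξ (π k) (-τ) 0 = Ξ k τ 0 ∧ Ξ (π k) (-τ) 1 = -(Ξ k τ 1) ∧
      Ξ (π k) (-τ) 2 = 2 * z₀ - Ξ k τ 2 := hsym k τ
  obtain ⟨hu0, hu1, hu2⟩ := induction_apply_partner hd hsym hπ γ hγ Γ hint (Ξ k τ) (Ξ (π k) (-τ)) hx'
  obtain ⟨hd0, hd1, hd2⟩ := deriv_apply_partner hd hsym k τ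
  obtain ⟨hJ0, hJ1, hJ2⟩ := cross_e3_apply (Ξ k τ)
  obtain ⟨hJ0', hJ1', hJ2'⟩ := cross_e3_apply (Ξ (π k) (-τ))
  -- components of the two tangency identities
  have h1 := heq k τ
  have h2 := heq (π k) (-τ)
  have c1 := fun i => congrArg (fun v => ⟪EuclideanSpace.single i (1 : ℝ), v⟫) h1
  have c2 := fun i => congrArg (fun v => ⟪EuclideanSpace.single i (1 : ℝ), v⟫) h2
  have e10 := c1 0
  have e11 := c1 1
  have e12 := c1 2
  have e20 := c2 0
  have e21 := c2 1
  have e22 := c2 2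
  simp only [inner_add_right, inner_sub_right, real_inner_smul_right, inner_single_left'] at e10 e11 e12
  simp only [inner_add_right, inner_sub_right, real_inner_smul_right, inner_single_left'] at e20 e21 e22
  rw [hu0, hJ0', hx'.1, hx'.2.1, hd0] at e20
  rw [hu1, hJ1', hx'.2.1, hx'.1, hd1] at e21
  rw [hu2, hJ2', hx'.2.2, hd2] at e22
  rw [hJ0] at e10
  rw [hJ1] at e11
  rw [hJ2] at e12
  ext i
  fin_cases i
  · simp only [PiLp.sub_apply, PiLp.smul_apply, smul_eq_mul]
    simp
    linarith
  · simp only [PiLp.sub_apply, PiLp.smul_apply, smul_eq_mul]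
    simp
    linarith
  · simp only [PiLp.sub_apply, PiLp.smul_apply, smul_eq_mul]
    simp
    linarith

/-- ★ **Every filament of a dihedral relative equilibrium passes through the centre `p = z₀e₃`.**
(Proper + continuous ⇒ `‖Ξ_k − p‖²` has a global minimum; there its derivative `2⟪Ξ_k − p, Ξ_k′⟫` vanishes,
and the radial law `Ξ_k − p = λ Ξ_k′` gives `λ‖Ξ_k′‖² = 0`, whence `Ξ_k − p = 0`.) [folklore] -/
theorem exists_eq_centre_of_dihedral (hπ : ∀ k, π (π k) = k) (γ : Fin N → ℝ) (hγ : ∀ k, γ (π k) = γ k)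
    (Γ α : ℝ) (w : Fin N → ℝ → ℝ)
    (hprop : ∀ k, Tendsto (fun τ => ‖Ξ k τ‖) atTop atTop ∧ Tendsto (fun τ => ‖Ξ k τ‖) atBot atTop)
    (hint : ∀ k (x : EuclideanSpace ℝ (Fin 3)), Integrable (fun σ : ℝ =>
      ((‖x - Ξ k σ‖ ^ 2 + 1) ^ (3 / 2 : ℝ))⁻¹ • cross (deriv (Ξ k) σ) (x - Ξ k σ)))
    (heq : ∀ k τ, (∑ m : Fin N, (Γ * γ m / (4 * Real.pi)) • ∫ σ : ℝ,
        ((‖Ξ k τ - Ξ m σ‖ ^ 2 + 1) ^ (3 / 2 : ℝ))⁻¹ • cross (deriv (Ξ m) σ) (Ξ k τ - Ξ m σ)) +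
        (1 / 2 : ℝ) • Ξ k τ - α • cross (EuclideanSpace.single (2 : Fin 3) (1 : ℝ)) (Ξ k τ) =
        w k τ • deriv (Ξ k) τ)
    (k : Fin N) : ∃ τ, Ξ k τ = z₀ • EuclideanSpace.single (2 : Fin 3) (1 : ℝ) := by
  set p : EuclideanSpace ℝ (Fin 3) := z₀ • EuclideanSpace.single (2 : Fin 3) (1 : ℝ) with hp
  set r : ℝ → EuclideanSpace ℝ (Fin 3) := fun τ => Ξ k τ - p with hr
  -- g = ‖r‖² is continuous and proper
  set g : ℝ → ℝ := fun τ => ⟪r τ, r τ⟫ with hg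
  have hrc : Continuous r := (hd k).continuous.sub continuous_const
  have hgc : Continuous g := hrc.inner hrc
  have hnorm_tend : ∀ {l : Filter ℝ}, Tendsto (fun τ => ‖Ξ k τ‖) l atTop → Tendsto g l atTop := by
    intro l hl
    have h1 : Tendsto (fun τ => ‖Ξ k τ‖ - ‖p‖) l atTop := tendsto_atTop_add_const_right _ _ hl
    have h2 : Tendsto (fun τ => ‖r τ‖) l atTop :=
      tendsto_atTop_mono (fun τ => by simpa [hr] using norm_sub_norm_le (Ξ k τ) p) h1
    have h3 : Tendsto (fun τ => ‖r τ‖ ^ 2) l atTop := (tendsto_pow_atTop two_ne_zero).comp h2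
    refine h3.congr fun τ => ?_
    simp [hg]
  have hlim : Tendsto g (cocompact ℝ) atTop := by
    rw [cocompact_eq_atBot_atTop]
    exact (hnorm_tend (hprop k).2).sup (hnorm_tend (hprop k).1)
  obtain ⟨τm, hτm⟩ := hgc.exists_forall_le hlim
  -- derivative of g at the minimum vanishes
  have hrd : HasDerivAt r (deriv (Ξ k) τm) τm := by
    simpa [hr] using ((hd k τm).hasDerivAt).sub_const p
  have hgd : HasDerivAt g (⟪r τm, deriv (Ξ k) τm⟫ + ⟪deriv (Ξ k) τm, r τm⟫) τm := hrd.inner ℝ hrd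
  have hmin : IsLocalMin g τm := Eventually.of_forall fun y => hτm y
  have hzero := hmin.hasDerivAt_eq_zero hgd
  have hcomm : ⟪r τm, deriv (Ξ k) τm⟫ = ⟪deriv (Ξ k) τm, r τm⟫ := real_inner_comm _ _
  -- radial law: r τm = λ • Ξ'
  have hrad : r τm = (w k τm - w (π k) (-τm)) • deriv (Ξ k) τm :=
    radial_law_of_dihedral hd hsym hπ γ hγ Γ α w hint heq k τm
  set lam : ℝ := w k τm - w (π k) (-τm) with hlam
  have hinner : ⟪r τm, deriv (Ξ k) τm⟫ = lam * ‖deriv (Ξ k) τm‖ ^ 2 := by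
    rw [hrad, real_inner_smul_left, real_inner_self_eq_norm_sq]
  have hl : lam * ‖deriv (Ξ k) τm‖ ^ 2 = 0 := by rw [← hinner]; linarith
  refine ⟨τm, ?_⟩
  have : r τm = 0 := by
    rcases mul_eq_zero.mp hl with h | h
    · rw [hrad, h, zero_smul]
    · have ht : deriv (Ξ k) τm = 0 := by
        have := pow_eq_zero_iff (n := 2) (by norm_num) |>.mp h
        exact norm_eq_zero.mp this
      rw [hrad, ht, smul_zero]
  simpa [hr, sub_eq_zero] using this

/-- ★ **Dihedral rigidity.** With, in addition, the separation clause of the crux (`d ≤ ‖Ξ_k τ − Ξ_m σ‖` for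
`k ≠ m`, some `d > 0`), a dihedrally symmetric relative equilibrium has at most ONE filament: all filaments
pass through the centre, so two distinct ones would meet. Hence no `C_N`-orbit (`N ≥ 2`) of a
half-turn-symmetric strand with equal circulations — the symmetric bending of the route's straight inner data —
is a witness of `SkeletonEquilibrium`; every witness is half-turn-chiral. [folklore] -/
theorem subsingleton_of_dihedral (hπ : ∀ k, π (π k) = k) (γ : Fin N → ℝ) (hγ : ∀ k, γ (π k) = γ k)
    (Γ α d : ℝ) (hdpos : 0 < d) (w : Fin N → ℝ → ℝ)
    (hprop : ∀ k, Tendsto (fun τ => ‖Ξ k τ‖) atTop atTop ∧ Tendsto (fun τ => ‖Ξ k τ‖) atBot atTop)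
    (hsep : ∀ k m, k ≠ m → ∀ τ σ, d ≤ ‖Ξ k τ - Ξ m σ‖)
    (hint : ∀ k (x : EuclideanSpace ℝ (Fin 3)), Integrable (fun σ : ℝ =>
      ((‖x - Ξ k σ‖ ^ 2 + 1) ^ (3 / 2 : ℝ))⁻¹ • cross (deriv (Ξ k) σ) (x - Ξ k σ)))
    (heq : ∀ k τ, (∑ m : Fin N, (Γ * γ m / (4 * Real.pi)) • ∫ σ : ℝ,
        ((‖Ξ k τ - Ξ m σ‖ ^ 2 + 1) ^ (3 / 2 : ℝ))⁻¹ • cross (deriv (Ξ m) σ) (Ξ k τ - Ξ m σ)) +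
        (1 / 2 : ℝ) • Ξ k τ - α • cross (EuclideanSpace.single (2 : Fin 3) (1 : ℝ)) (Ξ k τ) =
        w k τ • deriv (Ξ k) τ) :
    ∀ k m : Fin N, k = m := by
  intro k m
  by_contra hkm
  obtain ⟨τ, hτ⟩ := exists_eq_centre_of_dihedral hd hsym hπ γ hγ Γ α w hprop hint heq k
  obtain ⟨σ, hσ⟩ := exists_eq_centre_of_dihedral hd hsym hπ γ hγ Γ α w hprop hint heq m
  have h := hsep k m hkm τ σ
  rw [hτ, hσ, sub_self, norm_zero] at h
  linarith

/-- The same, as a bound on the number of filaments: `N ≤ 1`. [folklore] -/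
theorem card_le_one_of_dihedral (hπ : ∀ k, π (π k) = k) (γ : Fin N → ℝ) (hγ : ∀ k, γ (π k) = γ k)
    (Γ α d : ℝ) (hdpos : 0 < d) (w : Fin N → ℝ → ℝ)
    (hprop : ∀ k, Tendsto (fun τ => ‖Ξ k τ‖) atTop atTop ∧ Tendsto (fun τ => ‖Ξ k τ‖) atBot atTop)
    (hsep : ∀ k m, k ≠ m → ∀ τ σ, d ≤ ‖Ξ k τ - Ξ m σ‖)
    (hint : ∀ k (x : EuclideanSpace ℝ (Fin 3)), Integrable (fun σ : ℝ =>
      ((‖x - Ξ k σ‖ ^ 2 + 1) ^ (3 / 2 : ℝ))⁻¹ • cross (deriv (Ξ k) σ) (x - Ξ k σ)))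
    (heq : ∀ k τ, (∑ m : Fin N, (Γ * γ m / (4 * Real.pi)) • ∫ σ : ℝ,
        ((‖Ξ k τ - Ξ m σ‖ ^ 2 + 1) ^ (3 / 2 : ℝ))⁻¹ • cross (deriv (Ξ m) σ) (Ξ k τ - Ξ m σ)) +
        (1 / 2 : ℝ) • Ξ k τ - α • cross (EuclideanSpace.single (2 : Fin 3) (1 : ℝ)) (Ξ k τ) =
        w k τ • deriv (Ξ k) τ) :
    N ≤ 1 := by
  have hsub : Subsingleton (Fin N) :=
    ⟨subsingleton_of_dihedral hd hsym hπ γ hγ Γ α d hdpos w hprop hsep hint heq⟩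
  have := Fintype.card_le_one_iff_subsingleton.mpr hsub
  simpa using this

end Dihedral

end Summit.NavierStokesRegularity.NavierStokesRegularity.Theorems.SkeletonEquilibrium.DihedralRigidity
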